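import Summits.AtomisticToContinuum.HydrodynamicLimit.Theorems.CollisionIsometryCLTAdaptedWeightCLTBlockHDissipation
import Literature.Analysis.FluidPDE.CollisionWeakForm

/-!
# DV transfer for the line `block-h-dissipation-closure` (crux `AdaptedWeightCLT`, stmt-AtomisticToContinuum-14868),
# file 2: the exact Hellinger identity for the chaotic exponential moment

Support file (`--supports stmt-AtomisticToContinuum-14868`, anchor `bhDVTransfer_hellinger_anchor`) of the line lead
`prover-line-stmt-AtomisticToContinuum-14868-c4-0`, written for the registered stub `stub_dvTransfer` (S2).
Step (iii) of the stub's mechanism (TRIAGE-r1-3 Panel note A(5)): for pairs `(v, v_*, ω)` drawn from the chaotic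
flux-weighted pair law `f ⊗ f · B / Z(f)` (`B = hardSphereKernel`, `Z = fluxZ`), the exponential moment of one half
of the log-increment `ΔΛ = log f′ + log f′_* − log f − log f_*` is EXACTLY `1 − 𝒟h(f)`, `𝒟h = hellDiss` the
normalised Hellinger dissipation of the line's vocabulary:

* `fluxZ_eq_integral_collide` — the flux is collision invariant, `∫ B f′ f′_* = ∫ B f f_* = Z(f)`, by the
  measure-preserving involution `(v, v_*, ω) ↦ (v_*′, v′, ω)` of `dv dv_* dω` (tree:
  `Literature.Analysis.FluidPDE.integral_comp_collideSwap_prod`, `kernel_collideSwap`,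
  `isGradCutoffKernel_hardSphereKernel`); no integrability is needed;
* `integral_hellingerSq_eq` — for `f ≥ 0` measurable with `B f f_*` integrable:
  `∫ B (√(f′f′_*) − √(f f_*))² = 2 Z(f) − 2 ∫ B √(f f_* f′ f′_*)`;
* `one_sub_hellDiss_eq` — hence, when `Z(f) ≠ 0`, `1 − 𝒟h(f) = Z(f)⁻¹ ∫ B √(f f_* f′ f′_*)`, and for `f > 0` the
  exponential-moment form `Z(f)⁻¹ ∫ B f f_* · e^{ΔΛ/2} = 1 − 𝒟h(f)` (`integral_fluxPair_exp_half_eq`);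
* `hellDiss_nonneg`, `hellDiss_le_one` (`𝒟h ∈ [0, 1]`), `hellDiss_eq_zero_of_detailed_balance` and
  `hellDiss_localMaxwellian` (`𝒟h(M_{ρ,θ,u}) = 0`: at local equilibrium the chaotic dissipation vanishes).

No definitions. References: C. Cercignani, R. Illner, M. Pulvirenti, *The Mathematical Theory of Dilute Gases*
(1994) §3.1 p. 35 (unit Jacobian of the collision map), §3.2 [CIPDiluteGases1994].
-/

namespace Summit.AtomisticToContinuum.HydrodynamicLimit.Theorems.BlockHDissipation

open scoped BigOperators Topology Classical MeasureTheory ENNReal InnerProductSpace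
open Filter Set MeasureTheory Real
open Literature.Analysis.FluidPDE
open Summit.AtomisticToContinuum.HydrodynamicLimit.Theorems.ContactSourceDuhamel (T3 V3 Cfg Vel Flow Flows)
open Literature.MathematicalPhysics.KineticTheory (collide hardSphereKernel sphereMeasure)

noncomputable section

namespace DVTransfer

/-! ## The flux-preserving collision involution -/

/-- The hard-sphere kernel is invariant under the swapped collision map `(v, v_*, ω) ↦ (v_*′, v′, ω)`. -/
theorem hardSphereKernel_collideSwap (p : V3 × V3) (ω : Metric.sphere (0 : V3) 1) :
    hardSphereKernel (collide ω p).swap ω = hardSphereKernel p ω :=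
  kernel_collideSwap (B := hardSphereKernel (E := V3)) isGradCutoffKernel_hardSphereKernel.collide_neg
    isGradCutoffKernel_hardSphereKernel.swap_neg p ω

/-- `pairDirMeasure` is the measure `dv dv_* dω` of the tree's weak-form lemmas. -/
theorem pairDirMeasure_eq : pairDirMeasure = ((volume : Measure V3).prod volume).prod sphereMeasure := rfl

/-- **Change of variables along the collision involution** for a flux-weighted pair observable: for every
`F : V3 × V3 → ℝ`, `∫ B(q) F(v′, v_*′) = ∫ B(q) F(v_*, v)`… stated in the form used below:
`∫ B(q) F((collide q).swap) dq = ∫ B(q) F(q.1) dq` (no integrability needed: both sides are images of each other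
under a measure-preserving measurable involution). -/
theorem integral_kernel_mul_comp_collideSwap (F : V3 × V3 → ℝ) :
    ∫ q : PairDir, hardSphereKernel q.1 q.2 * F (collide q.2 q.1).swap ∂pairDirMeasure =
      ∫ q : PairDir, hardSphereKernel q.1 q.2 * F q.1 ∂pairDirMeasure := by
  have h := integral_comp_collideSwap_prod (E := V3)
    (fun q : PairDir => hardSphereKernel q.1 q.2 * F q.1)
  rw [pairDirMeasure_eq, ← h]
  refine integral_congr_ae (Eventually.of_forall fun q => ?_)
  simp only [hardSphereKernel_collideSwap]

/-- **The flux is collision invariant**: `∫ B f(v′) f(v_*′) dv dv_* dω = ∫ B f(v) f(v_*) dv dv_* dω = Z(f)`. -/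
theorem fluxZ_eq_integral_collide (f : V3 → ℝ) :
    ∫ q : PairDir, hardSphereKernel q.1 q.2 * (f (collide q.2 q.1).1 * f (collide q.2 q.1).2) ∂pairDirMeasure =
      fluxZ f := by
  have h := integral_kernel_mul_comp_collideSwap (fun p => f p.1 * f p.2)
  simp only [Prod.fst_swap, Prod.snd_swap] at h
  rw [fluxZ, ← h]
  refine integral_congr_ae (Eventually.of_forall fun q => ?_)
  simp only
  ring

/-- Integrability of the flux-weighted pair observable is invariant under the collision involution. -/
theorem integrable_kernel_mul_comp_collide_iff (F : V3 × V3 → ℝ) :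
    Integrable (fun q : PairDir => hardSphereKernel q.1 q.2 * F (collide q.2 q.1).swap) pairDirMeasure ↔
      Integrable (fun q : PairDir => hardSphereKernel q.1 q.2 * F q.1) pairDirMeasure := by
  have h := integrable_comp_collideSwap_prod_iff (E := V3)
    (fun q : PairDir => hardSphereKernel q.1 q.2 * F q.1)
  rw [pairDirMeasure_eq, ← h]
  refine integrable_congr (Eventually.of_forall fun q => ?_)
  simp only [hardSphereKernel_collideSwap]

/-! ## The Hellinger identity -/

/-- Pointwise expansion of the Hellinger square for nonnegative pair products:
`(√a′ − √a)² = a′ + a − 2 √(a a′)` (`a, a′ ≥ 0`). -/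
theorem sqrt_sub_sqrt_sq {a a' : ℝ} (ha : 0 ≤ a) (ha' : 0 ≤ a') :
    (Real.sqrt a' - Real.sqrt a) ^ 2 = a' + a - 2 * Real.sqrt (a * a') := by
  rw [sub_sq, sq_sqrt ha', sq_sqrt ha, sqrt_mul ha]
  ring

/-- The hard-sphere kernel is continuous on `PairDir`. -/
theorem continuous_hardSphereKernel_pairDir :
    Continuous fun q : PairDir => hardSphereKernel q.1 q.2 := by
  unfold hardSphereKernel
  fun_prop

/-- Measurability of the flux-weighted pair product `B f f_*` for measurable `f`. -/
theorem measurable_kernel_mul_pair {f : V3 → ℝ} (hf : Measurable f) :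
    Measurable fun q : PairDir => hardSphereKernel q.1 q.2 * (f q.1.1 * f q.1.2) :=
  continuous_hardSphereKernel_pairDir.measurable.mul
    ((hf.comp (measurable_fst.comp measurable_fst)).mul (hf.comp (measurable_snd.comp measurable_fst)))

/-- Measurability of the post-collisional pair product `B f′ f′_*` for measurable `f`. -/
theorem measurable_kernel_mul_pair_collide {f : V3 → ℝ} (hf : Measurable f) :
    Measurable fun q : PairDir => hardSphereKernel q.1 q.2 * (f (collide q.2 q.1).1 * f (collide q.2 q.1).2) := by
  have hc : Measurable fun q : PairDir => collide q.2 q.1 := continuous_collide_uncurry.measurable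
  exact continuous_hardSphereKernel_pairDir.measurable.mul
    ((hf.comp (measurable_fst.comp hc)).mul (hf.comp (measurable_snd.comp hc)))

/-- Integrability of `B f f_*` transfers to `B f′ f′_*`. -/
theorem integrable_kernel_mul_pair_collide {f : V3 → ℝ}
    (hint : Integrable (fun q : PairDir => hardSphereKernel q.1 q.2 * (f q.1.1 * f q.1.2)) pairDirMeasure) :
    Integrable (fun q : PairDir => hardSphereKernel q.1 q.2 * (f (collide q.2 q.1).1 * f (collide q.2 q.1).2))
      pairDirMeasure := by
  have h := (integrable_kernel_mul_comp_collide_iff (fun p => f p.1 * f p.2)).2 hint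
  simp only [Prod.fst_swap, Prod.snd_swap] at h
  refine h.congr (Eventually.of_forall fun q => ?_)
  simp only
  ring

/-- Integrability of the Hellinger cross term `B √(f f_* f′ f′_*)` (dominated by `B (f f_* + f′ f′_*)/2`). -/
theorem integrable_kernel_mul_sqrt {f : V3 → ℝ} (hf : Measurable f) (hf0 : ∀ v, 0 ≤ f v)
    (hint : Integrable (fun q : PairDir => hardSphereKernel q.1 q.2 * (f q.1.1 * f q.1.2)) pairDirMeasure) :
    Integrable (fun q : PairDir => hardSphereKernel q.1 q.2 *
      Real.sqrt (f q.1.1 * f q.1.2 * (f (collide q.2 q.1).1 * f (collide q.2 q.1).2))) pairDirMeasure := by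
  have hdom : Integrable (fun q : PairDir => (hardSphereKernel q.1 q.2 * (f q.1.1 * f q.1.2) +
      hardSphereKernel q.1 q.2 * (f (collide q.2 q.1).1 * f (collide q.2 q.1).2)) / 2) pairDirMeasure :=
    (hint.add (integrable_kernel_mul_pair_collide hint)).div_const 2
  have hc : Measurable fun q : PairDir => collide q.2 q.1 := continuous_collide_uncurry.measurable
  refine hdom.mono' ?_ (Eventually.of_forall fun q => ?_)
  · exact (continuous_hardSphereKernel_pairDir.measurable.mul
      ((((hf.comp (measurable_fst.comp measurable_fst)).mul (hf.comp (measurable_snd.comp measurable_fst))).mul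
        ((hf.comp (measurable_fst.comp hc)).mul (hf.comp (measurable_snd.comp hc)))).sqrt)).aestronglyMeasurable
  · have hB : 0 ≤ hardSphereKernel q.1 q.2 := le_max_right _ _
    have ha : 0 ≤ f q.1.1 * f q.1.2 := mul_nonneg (hf0 _) (hf0 _)
    have ha' : 0 ≤ f (collide q.2 q.1).1 * f (collide q.2 q.1).2 := mul_nonneg (hf0 _) (hf0 _)
    rw [Real.norm_eq_abs, abs_of_nonneg (mul_nonneg hB (Real.sqrt_nonneg _))]
    -- AM–GM `√(a a′) ≤ (a + a′)/2` (cf. `Literature.Analysis.FluidPDE.sqrt_mul_le_add_half`)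
    have hamgm : Real.sqrt (f q.1.1 * f q.1.2 * (f (collide q.2 q.1).1 * f (collide q.2 q.1).2)) ≤
        (f q.1.1 * f q.1.2 + f (collide q.2 q.1).1 * f (collide q.2 q.1).2) / 2 := by
      have h := sqrt_sub_sqrt_sq ha ha'
      nlinarith [sq_nonneg (Real.sqrt (f (collide q.2 q.1).1 * f (collide q.2 q.1).2) - Real.sqrt (f q.1.1 * f q.1.2)), h]
    have := mul_le_mul_of_nonneg_left hamgm hB
    linarith

/-- **The Hellinger expansion**: for `f ≥ 0` measurable with `B f f_*` integrable,
`∫ B (√(f′ f′_*) − √(f f_*))² = 2 Z(f) − 2 ∫ B √(f f_* f′ f′_*)`. -/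
theorem integral_hellingerSq_eq {f : V3 → ℝ} (hf : Measurable f) (hf0 : ∀ v, 0 ≤ f v)
    (hint : Integrable (fun q : PairDir => hardSphereKernel q.1 q.2 * (f q.1.1 * f q.1.2)) pairDirMeasure) :
    ∫ q : PairDir, hardSphereKernel q.1 q.2 *
        (Real.sqrt (f (collide q.2 q.1).1 * f (collide q.2 q.1).2) - Real.sqrt (f q.1.1 * f q.1.2)) ^ 2
        ∂pairDirMeasure =
      2 * fluxZ f - 2 * ∫ q : PairDir, hardSphereKernel q.1 q.2 *
        Real.sqrt (f q.1.1 * f q.1.2 * (f (collide q.2 q.1).1 * f (collide q.2 q.1).2)) ∂pairDirMeasure := by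
  have hpt : ∀ q : PairDir, hardSphereKernel q.1 q.2 *
      (Real.sqrt (f (collide q.2 q.1).1 * f (collide q.2 q.1).2) - Real.sqrt (f q.1.1 * f q.1.2)) ^ 2 =
      hardSphereKernel q.1 q.2 * (f (collide q.2 q.1).1 * f (collide q.2 q.1).2) +
        hardSphereKernel q.1 q.2 * (f q.1.1 * f q.1.2) -
        2 * (hardSphereKernel q.1 q.2 *
          Real.sqrt (f q.1.1 * f q.1.2 * (f (collide q.2 q.1).1 * f (collide q.2 q.1).2))) := by
    intro q
    rw [sqrt_sub_sqrt_sq (mul_nonneg (hf0 _) (hf0 _)) (mul_nonneg (hf0 _) (hf0 _))]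
    ring
  simp_rw [hpt]
  have i1 : Integrable (fun q : PairDir => hardSphereKernel q.1 q.2 * (f (collide q.2 q.1).1 * f (collide q.2 q.1).2) +
      hardSphereKernel q.1 q.2 * (f q.1.1 * f q.1.2)) pairDirMeasure :=
    (integrable_kernel_mul_pair_collide hint).add hint
  have i2 : Integrable (fun q : PairDir => 2 * (hardSphereKernel q.1 q.2 *
      Real.sqrt (f q.1.1 * f q.1.2 * (f (collide q.2 q.1).1 * f (collide q.2 q.1).2)))) pairDirMeasure :=
    (integrable_kernel_mul_sqrt hf hf0 hint).const_mul 2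
  rw [integral_sub i1 i2, integral_add (integrable_kernel_mul_pair_collide hint) hint, integral_const_mul,
    fluxZ_eq_integral_collide, fluxZ]
  ring

/-- **The exact Hellinger identity** (`1 − 𝒟h = E_{ff_*B/Z} √(f′f′_*/(f f_*))`): for `f ≥ 0` measurable with
`B f f_*` integrable and `Z(f) ≠ 0`, `1 − hellDiss f = Z(f)⁻¹ ∫ B √(f f_* f′ f′_*)`. -/
theorem one_sub_hellDiss_eq {f : V3 → ℝ} (hf : Measurable f) (hf0 : ∀ v, 0 ≤ f v)
    (hint : Integrable (fun q : PairDir => hardSphereKernel q.1 q.2 * (f q.1.1 * f q.1.2)) pairDirMeasure)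
    (hZ : fluxZ f ≠ 0) :
    1 - hellDiss f = (fluxZ f)⁻¹ * ∫ q : PairDir, hardSphereKernel q.1 q.2 *
        Real.sqrt (f q.1.1 * f q.1.2 * (f (collide q.2 q.1).1 * f (collide q.2 q.1).2)) ∂pairDirMeasure := by
  rw [hellDiss, integral_hellingerSq_eq hf hf0 hint]
  field_simp
  ring

/-- The flux is nonnegative for `f ≥ 0`. -/
theorem fluxZ_nonneg {f : V3 → ℝ} (hf0 : ∀ v, 0 ≤ f v) : 0 ≤ fluxZ f :=
  integral_nonneg fun q => mul_nonneg ((le_max_right _ _ : 0 ≤ hardSphereKernel q.1 q.2)) (mul_nonneg (hf0 _) (hf0 _))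

/-- `𝒟h ≥ 0` for `f ≥ 0` (a normalised integral of squares; `Z(f) ≥ 0`). -/
theorem hellDiss_nonneg {f : V3 → ℝ} (hf0 : ∀ v, 0 ≤ f v) : 0 ≤ hellDiss f := by
  unfold hellDiss
  refine mul_nonneg (inv_nonneg.2 (mul_nonneg zero_le_two (fluxZ_nonneg hf0))) (integral_nonneg fun q => ?_)
  exact mul_nonneg ((le_max_right _ _ : 0 ≤ hardSphereKernel q.1 q.2)) (sq_nonneg _)

/-- `𝒟h ≤ 1` for `f ≥ 0` measurable with `B f f_*` integrable (the cross term `∫ B √(f f_* f′f′_*)` is `≥ 0`;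
if `Z(f) = 0` then `𝒟h = 0` by the junk convention `0⁻¹ = 0`). -/
theorem hellDiss_le_one {f : V3 → ℝ} (hf : Measurable f) (hf0 : ∀ v, 0 ≤ f v)
    (hint : Integrable (fun q : PairDir => hardSphereKernel q.1 q.2 * (f q.1.1 * f q.1.2)) pairDirMeasure) :
    hellDiss f ≤ 1 := by
  by_cases hZ : fluxZ f = 0
  · rw [hellDiss, hZ, mul_zero, inv_zero, zero_mul]; exact zero_le_one
  · have h := one_sub_hellDiss_eq hf hf0 hint hZ
    have hI : 0 ≤ ∫ q : PairDir, hardSphereKernel q.1 q.2 *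
        Real.sqrt (f q.1.1 * f q.1.2 * (f (collide q.2 q.1).1 * f (collide q.2 q.1).2)) ∂pairDirMeasure :=
      integral_nonneg fun q => mul_nonneg ((le_max_right _ _ : 0 ≤ hardSphereKernel q.1 q.2)) (Real.sqrt_nonneg _)
    have hZpos : 0 < fluxZ f := lt_of_le_of_ne (fluxZ_nonneg hf0) (Ne.symm hZ)
    have : 0 ≤ (fluxZ f)⁻¹ * ∫ q : PairDir, hardSphereKernel q.1 q.2 *
        Real.sqrt (f q.1.1 * f q.1.2 * (f (collide q.2 q.1).1 * f (collide q.2 q.1).2)) ∂pairDirMeasure :=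
      mul_nonneg (inv_nonneg.2 hZpos.le) hI
    linarith

/-- **Exponential-moment form** (the shape consumed by Donsker–Varadhan with `φ = ½ ΔΛ`): for `f > 0`
measurable with `B f f_*` integrable and `Z(f) ≠ 0`,
`Z(f)⁻¹ ∫ B f f_* · exp (½ (log f′ + log f′_* − log f − log f_*)) = 1 − 𝒟h(f)`. -/
theorem integral_fluxPair_exp_half_eq {f : V3 → ℝ} (hf : Measurable f) (hfpos : ∀ v, 0 < f v)
    (hint : Integrable (fun q : PairDir => hardSphereKernel q.1 q.2 * (f q.1.1 * f q.1.2)) pairDirMeasure)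
    (hZ : fluxZ f ≠ 0) :
    (fluxZ f)⁻¹ * ∫ q : PairDir, hardSphereKernel q.1 q.2 * (f q.1.1 * f q.1.2) *
        Real.exp (2⁻¹ * (Real.log (f (collide q.2 q.1).1) + Real.log (f (collide q.2 q.1).2) -
          Real.log (f q.1.1) - Real.log (f q.1.2))) ∂pairDirMeasure = 1 - hellDiss f := by
  rw [one_sub_hellDiss_eq hf (fun v => (hfpos v).le) hint hZ]
  congr 1
  refine integral_congr_ae (Eventually.of_forall fun q => ?_)
  have h1 := hfpos q.1.1
  have h2 := hfpos q.1.2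
  have h3 := hfpos (collide q.2 q.1).1
  have h4 := hfpos (collide q.2 q.1).2
  simp only
  have hexp : Real.exp (2⁻¹ * (Real.log (f (collide q.2 q.1).1) + Real.log (f (collide q.2 q.1).2) -
      Real.log (f q.1.1) - Real.log (f q.1.2))) =
      Real.sqrt (f (collide q.2 q.1).1 * f (collide q.2 q.1).2 / (f q.1.1 * f q.1.2)) := by
    rw [Real.sqrt_eq_rpow, Real.rpow_def_of_pos (div_pos (mul_pos h3 h4) (mul_pos h1 h2)),
      Real.log_div (mul_pos h3 h4).ne' (mul_pos h1 h2).ne', Real.log_mul h3.ne' h4.ne', Real.log_mul h1.ne' h2.ne']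
    congr 1
    ring
  rw [hexp, mul_assoc]
  congr 1
  have h12 : 0 < f q.1.1 * f q.1.2 := mul_pos h1 h2
  rw [← Real.sqrt_sq h12.le, ← Real.sqrt_mul (sq_nonneg _), Real.sqrt_sq h12.le]
  congr 1
  field_simp

/-! ## Vanishing at (local) equilibrium -/

/-- If `f` satisfies detailed balance `f′ f′_* = f f_*` pointwise, then `𝒟h(f) = 0`. -/
theorem hellDiss_eq_zero_of_detailed_balance {f : V3 → ℝ}
    (h : ∀ (p : V3 × V3) (ω : Metric.sphere (0 : V3) 1), f (collide ω p).1 * f (collide ω p).2 = f p.1 * f p.2) :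
    hellDiss f = 0 := by
  rw [hellDiss]
  have : (fun q : PairDir => hardSphereKernel q.1 q.2 *
      (Real.sqrt (f (collide q.2 q.1).1 * f (collide q.2 q.1).2) - Real.sqrt (f q.1.1 * f q.1.2)) ^ 2) =
      fun _ => 0 := by
    funext q; rw [h q.1 q.2, sub_self]; ring
  rw [this, integral_zero, mul_zero]

/-- The collision law commutes with a common translation of both velocities. -/
theorem collide_sub_const (ω : Metric.sphere (0 : V3) 1) (p : V3 × V3) (u : V3) :
    collide ω (p.1 - u, p.2 - u) = ((collide ω p).1 - u, (collide ω p).2 - u) := by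
  simp only [collide, Prod.mk.injEq]
  have : p.1 - u - (p.2 - u) = p.1 - p.2 := by abel
  rw [this]
  exact ⟨by abel, by abel⟩

/-- Local Maxwellians satisfy detailed balance: `M(v′) M(v_*′) = M(v) M(v_*)` (conservation of the kinetic energy
relative to the bulk velocity `u`). -/
theorem localMaxwellian_detailed_balance (ρ θ : ℝ) (u : V3) (p : V3 × V3) (ω : Metric.sphere (0 : V3) 1) :
    localMaxwellian ρ θ u (collide ω p).1 * localMaxwellian ρ θ u (collide ω p).2 =
      localMaxwellian ρ θ u p.1 * localMaxwellian ρ θ u p.2 := by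
  have hE := Literature.MathematicalPhysics.KineticTheory.norm_sq_collide_fst_add_norm_sq_collide_snd ω (p.1 - u, p.2 - u)
  rw [collide_sub_const] at hE
  simp only at hE
  simp only [localMaxwellian]
  have key : Real.exp (-‖(collide ω p).1 - u‖ ^ 2 / (2 * θ)) * Real.exp (-‖(collide ω p).2 - u‖ ^ 2 / (2 * θ)) =
      Real.exp (-‖p.1 - u‖ ^ 2 / (2 * θ)) * Real.exp (-‖p.2 - u‖ ^ 2 / (2 * θ)) := by
    rw [← Real.exp_add, ← Real.exp_add]
    congr 1
    rw [← add_div, ← add_div, ← neg_add, ← neg_add, hE]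
  calc ρ * (2 * Real.pi * θ) ^ (-(Module.finrank ℝ V3 : ℝ) / 2) * Real.exp (-‖(collide ω p).1 - u‖ ^ 2 / (2 * θ)) *
        (ρ * (2 * Real.pi * θ) ^ (-(Module.finrank ℝ V3 : ℝ) / 2) * Real.exp (-‖(collide ω p).2 - u‖ ^ 2 / (2 * θ)))
      = (ρ * (2 * Real.pi * θ) ^ (-(Module.finrank ℝ V3 : ℝ) / 2)) ^ 2 *
          (Real.exp (-‖(collide ω p).1 - u‖ ^ 2 / (2 * θ)) * Real.exp (-‖(collide ω p).2 - u‖ ^ 2 / (2 * θ))) := by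
        ring
    _ = (ρ * (2 * Real.pi * θ) ^ (-(Module.finrank ℝ V3 : ℝ) / 2)) ^ 2 *
          (Real.exp (-‖p.1 - u‖ ^ 2 / (2 * θ)) * Real.exp (-‖p.2 - u‖ ^ 2 / (2 * θ))) := by rw [key]
    _ = _ := by ring

/-- **No chaotic dissipation at local equilibrium**: `𝒟h(M_{ρ,θ,u}) = 0` for every local Maxwellian (any
parameters; this is why the co-moving co-thermal floor of `cellLaw` does not spoil the line). -/
theorem hellDiss_localMaxwellian (ρ θ : ℝ) (u : V3) : hellDiss (localMaxwellian ρ θ u) = 0 :=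
  hellDiss_eq_zero_of_detailed_balance fun p ω => localMaxwellian_detailed_balance ρ θ u p ω

end DVTransfer

/-! ## Registered anchor of this support file -/

/-- ANCHOR (registered helper stub `bhDVTransfer_hellinger_anchor` of the crux item): the exact Hellinger identity —
for a nonnegative measurable `f` with integrable flux density `B f f_*` and `Z(f) ≠ 0`,
`1 − hellDiss f = (fluxZ f)⁻¹ ∫ B √(f f_* f′ f′_*)`. -/
theorem bhDVTransfer_hellinger_anchor : ∀ (f : V3 → ℝ), Measurable f → (∀ v, 0 ≤ f v) → MeasureTheory.Integrable (fun q : PairDir => hardSphereKernel q.1 q.2 * (f q.1.1 * f q.1.2)) pairDirMeasure → fluxZ f ≠ 0 → 1 - hellDiss f = (fluxZ f)⁻¹ * ∫ q : PairDir, hardSphereKernel q.1 q.2 * Real.sqrt (f q.1.1 * f q.1.2 * (f (collide q.2 q.1).1 * f (collide q.2 q.1).2)) ∂pairDirMeasure :=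
  fun _ hf hf0 hint hZ => DVTransfer.one_sub_hellDiss_eq hf hf0 hint hZ

end

end Summit.AtomisticToContinuum.HydrodynamicLimit.Theorems.BlockHDissipation
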